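import Summits.BirchSwinnertonDyer.BirchSwinnertonDyer.Theorems.UniversalToricDescentTwinControlGlueOfClauses
import HarnessLib

/-!
# The twin control-glue letters AT A FIXED PRIME `p`: `Stmt.readoutSelmerMultAt p`, `Stmt.readoutIndexMultAt p`,
# `Stmt.controlGlueMultAt p`, the assembly `controlGlueMultAt_of_clauses`, (B4) at every `p`

Summits-side helper toward the registered stub `stub_howardOutputsOfFamily` (K2) of line `beta-road` (skeleton v10
cd44fe9d5c6b9a78) of crux r205 stmt-BirchSwinnertonDyer-24737 `…Theses.UniversalToricDescent.TwinAlgMuZeroAtThree` (LEAD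
lineage `bsd-wall-utd-p1`, g26; `--supports`).  ROUTE-INDEPENDENT; letters (`abbrev … : Prop`) and theorems; no named fact, no
instance, no `sorry`.

`UniversalToricDescentTwinControlGlueOfClauses` (p764670) re-framed x10b's letters (B4)/(B5)/controlGlue on the twin frame as CLOSED
propositions (the prime `p` universally quantified inside, as in x10b).  The twin's clause (B5-P) at the places above `p` is a
theorem at `p = 3` (`UniversalToricDescentTwinReadoutLocalIndexThreeUnconditional`, p763986), so the (B5) letter the twin can
discharge is the one AT `p = 3`.  This file pulls `p` out of the three letters (bodies VERBATIM otherwise) and repeats the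
assembly at a fixed prime:
* `Stmt.readoutSelmerMultAt p`, `Stmt.readoutIndexMultAt p`, `Stmt.controlGlueMultAt p`;
* **`controlGlueMultAt_of_clauses : Stmt.readoutSelmerMultAt p → Stmt.readoutIndexMultAt p → Stmt.controlGlueMultAt p`**
  (x10b's proof verbatim; ORD-ASCENT by `LambdaAdicSelmerData.toEisensteinH1Linear_mem_ordinarySelmer_of_multiplicative`, p764422);
* **`readoutSelmerMultAt_holds p`** ((B4) at every `p`, from `readoutSelmerMult_holds`) and
  **`controlGlueMultAt_of_readoutIndexMultAt : Stmt.readoutIndexMultAt p → Stmt.controlGlueMultAt p`**.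
What this is NOT: (B5) at `p = 3` itself (next file), Howard's `Conclusion` for the twin, (H-i′)/(H-ii).  No summit statement is
proved; BSD is not proved by any of this.

References: [Howard2004HeegnerKolyvagin] Thm. 1.6.1, Lemma 2.2.7, Prop. 2.2.8 and proof of Thm. 2.2.10 (𝔮 = T^m + p);
[GreenbergLNM1716] §2 p. 76, Prop. 2.4.
-/

set_option linter.dupNamespace false
set_option autoImplicit false

noncomputable section

open scoped Classical Pointwise ContRepresentation TensorProduct NumberField

open Function NumberField IsDedekindDomain Field
open Literature Literature.NumberTheory.EllipticCurves WeierstrassCurve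
open Literature.NumberTheory.GaloisCohomology Literature.NumberTheory.GaloisCohomology.Howard2004
open Literature.NumberTheory.GaloisRepresentations Literature.NumberTheory.GaloisRepresentations.DiscreteGaloisModule
open Summit.BirchSwinnertonDyer.BirchSwinnertonDyer.Theorems

namespace Summit.BirchSwinnertonDyer.BirchSwinnertonDyer.Theorems.UniversalToricDescentTwinControlGlue

/-! ## §1 The letters -/

set_option synthInstance.maxHeartbeats 80000 in
/-- **Letter (B4) `readoutSelmer`** — the image of Howard's propagated Selmer group `H¹_{F_𝔮}(K, A_𝔮)` under the readout
`H¹(K, A_𝔮) → H¹(K_∞, E[p^∞])` lies in `Sel_{p^∞}(E/K_∞)`, for `m ≫ 0` and every admissible Eisenstein datum (x10b-p2's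
local conditions §2; Greenberg LNM 1716 Prop. 2.4 = the Kummer image at `w ∣ p` is its leading binder). -/
abbrev Stmt.readoutSelmerMultAt (p : ℕ) [Fact p.Prime] : Prop :=
  ∀ (N : ℕ) [NeZero N] (W : WeierstrassCurve ℚ) [W.IsElliptic] [W.IsGloballyMinimal] (K : Type) [Field K] [NumberField K]
    (κ : ZpExtension K p) (γ : Field.absoluteGaloisGroup K),
    IsImaginaryQuadratic K → p ≠ 2 → κ.IsAnticyclotomic → SatisfiesHeegnerHypothesis N K →
    ∀ (hγ : κ.IsTopGenerator γ) (hE : ∀ Q : (W.baseChange K).toAffine.Point, p • Q = 0 → Q = 0),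
    (∀ v : IsDedekindDomain.HeightOneSpectrum (NumberField.RingOfIntegers K),
      ((p : ℕ) : NumberField.RingOfIntegers K) ∈ v.asIdeal → (W.baseChange K).HasMultiplicativeReductionAt v) →
    ∃ m₁ : ℕ, ∀ (m : ℕ) (hm : 1 ≤ m), m₁ ≤ m →
      letI := IwasawaAlgebra.isDomain_quotient_X_pow_add_C p hm
      letI := IwasawaAlgebra.isDiscreteValuationRing_quotient_X_pow_add_C p hm
      haveI := IwasawaAlgebra.EisensteinCoeff.isLocalRing_succ p hm
      letI := IwasawaAlgebra.EisensteinCoeff.algebraOfSpecSucc p m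
      haveI := W.isScalarTower_algebraOfSpecSucc (K := K) (p := p) (m := m)
      letI := W.residueModuleSucc (K := K) (p := p) hm
      ∀ (S : Finset (IsDedekindDomain.HeightOneSpectrum (NumberField.RingOfIntegers K)))
        (hpS : ∀ v, ((p : ℕ) : NumberField.RingOfIntegers K) ∈ v.asIdeal → v ∈ S)
        (hbad : ∀ v, v ∉ S → ((p : ℕ) : NumberField.RingOfIntegers K) ∉ v.asIdeal →
          (W.baseChange K).HasGoodReductionAt v)
        (_hSN : ∀ v ∈ S, ((p : ℕ) : NumberField.RingOfIntegers K) ∈ v.asIdeal ∨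
          ((N : ℕ) : NumberField.RingOfIntegers K) ∈ v.asIdeal)
        (_hSσ : ∀ (σ : K ≃ₐ[ℚ] K) (v : IsDedekindDomain.HeightOneSpectrum (NumberField.RingOfIntegers K)),
          σ • v ∈ S → v ∈ S)
        (L : Set (IsDedekindDomain.HeightOneSpectrum (NumberField.RingOfIntegers K)))
        (hL : L ⊆ (W.eisensteinTower (κ.unitTwist (-1)) hm).degreeTwoPrimes p)
        (hLS : ∀ v ∈ L, v ∉ S) (jbar' : AlgebraicClosure K →+* ℂ) (cd : ConjugationDatum K)
        (Dd : ∀ k, DualityDatum p cd ((W.eisensteinTower (κ.unitTwist (-1)) hm).ρ k)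
          (IwasawaAlgebra.EisensteinCoeff p m (k + 1)))
        (fs : ∀ (k : ℕ) (n : Finset (IsDedekindDomain.HeightOneSpectrum (NumberField.RingOfIntegers K)))
          (v : IsDedekindDomain.HeightOneSpectrum (NumberField.RingOfIntegers K)),
          galoisCohomology ((W.eisensteinLevelQuot (κ.unitTwist (-1)) hm k n).toLocal (Sum.inr v)) 1 →+
            SingularQuotient (GaloisRep.toLocal v (W.eisensteinLevelQuot (κ.unitTwist (-1)) hm k n)) ⊗[ℤ]
              Gell v)
        (hy : (W.eisensteinDVRSetting (κ.unitTwist (-1)) hm S hpS hbad L hL hLS jbar' cd Dd fs).SatisfiesH)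
        (hπ : (W.eisensteinDVRSetting (κ.unitTwist (-1)) hm S hpS hbad L hL hLS jbar' cd Dd fs).π ∈ IsLocalRing.maximalIdeal (IwasawaAlgebra p ⧸ Ideal.span {(PowerSeries.X ^ m + PowerSeries.C (p : ℤ_[p]) : IwasawaAlgebra p)}))
        (he : ∀ k, (W.eisensteinDVRSetting (κ.unitTwist (-1)) hm S hpS hbad L hL hLS jbar' cd Dd fs).e k ≤ (W.eisensteinDVRSetting (κ.unitTwist (-1)) hm S hpS hbad L hL hLS jbar' cd Dd fs).e (k + 1))
        (hπX : (W.eisensteinDVRSetting (κ.unitTwist (-1)) hm S hpS hbad L hL hLS jbar' cd Dd fs).π =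
          Ideal.Quotient.mk (Ideal.span {(PowerSeries.X ^ m + PowerSeries.C (p : ℤ_[p]) : IwasawaAlgebra p)}) PowerSeries.X)
        (hek : ∀ k, (W.eisensteinDVRSetting (κ.unitTwist (-1)) hm S hpS hbad L hL hLS jbar' cd Dd fs).e (k + 1) - (W.eisensteinDVRSetting (κ.unitTwist (-1)) hm S hpS hbad L hL hLS jbar' cd Dd fs).e k = m),
        ∀ a ∈ ((W.eisensteinDVRSetting (κ.unitTwist (-1)) hm S hpS hbad L hL hLS jbar' cd Dd fs).T.selmerA (W.eisensteinDVRSetting (κ.unitTwist (-1)) hm S hpS hbad L hL hLS jbar' cd Dd fs).π (W.eisensteinDVRSetting (κ.unitTwist (-1)) hm S hpS hbad L hL hLS jbar' cd Dd fs).e hy.killed hy.ker_red hπ he (fun k ↦ ((W.eisensteinDVRSetting (κ.unitTwist (-1)) hm S hpS hbad L hL hLS jbar' cd Dd fs).t k).cond)),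
          (W.eisensteinTowerReadout κ hm (W.eisensteinDVRSetting (κ.unitTwist (-1)) hm S hpS hbad L hL hLS jbar' cd Dd fs).π (W.eisensteinDVRSetting (κ.unitTwist (-1)) hm S hpS hbad L hL hLS jbar' cd Dd fs).e hy.killed hy.ker_red hπ he hπX hek) a ∈ (W.baseChange K).selmerInfty κ

set_option synthInstance.maxHeartbeats 80000 in
/-- **Letter (B5) on the twin frame AT A FIXED PRIME `p`, `Stmt.readoutIndexMultAt p`** — the m-UNIFORM index bound: for `m ≫ 0` and every admissible
Eisenstein datum, `Sel_{p^∞}(E/K_∞)[(conj_γ − 1)^m + p]` modulo the readout of `H¹_{F_𝔮}(K, A_𝔮)` is finite of order `≤ p^c`,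
`c` independent of `m` (Howard Prop. 2.2.8, second map, at `𝔮 = T^m + p`); x10b's `Stmt.readoutIndex` with the print frame
replaced by the twin frame (multiplicative reduction above `p`).  A LETTER (not asserted): its clause at `v ∣ p` is the theorem
`UniversalToricDescentTwinReadoutLocalIndexThreeUnconditional.readoutLocalIndexThree_at_…` (p763986, `p = 3`); the clauses off
`S` and at `v ∣ N` and the assembly `readoutIndex_of_localClauses` are x10b's, still on the print frame. -/
abbrev Stmt.readoutIndexMultAt (p : ℕ) [Fact p.Prime] : Prop :=
  ∀ (N : ℕ) [NeZero N] (W : WeierstrassCurve ℚ) [W.IsElliptic] [W.IsGloballyMinimal] (K : Type) [Field K] [NumberField K]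
    (κ : ZpExtension K p) (γ : Field.absoluteGaloisGroup K),
    IsImaginaryQuadratic K → p ≠ 2 → κ.IsAnticyclotomic → SatisfiesHeegnerHypothesis N K →
    ∀ (hγ : κ.IsTopGenerator γ) (hE : ∀ Q : (W.baseChange K).toAffine.Point, p • Q = 0 → Q = 0),
    (∀ v : IsDedekindDomain.HeightOneSpectrum (NumberField.RingOfIntegers K),
      ((p : ℕ) : NumberField.RingOfIntegers K) ∈ v.asIdeal → (W.baseChange K).HasMultiplicativeReductionAt v) →
    ∃ c m₁ : ℕ, ∀ (m : ℕ) (hm : 1 ≤ m), m₁ ≤ m →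
      letI := IwasawaAlgebra.isDomain_quotient_X_pow_add_C p hm
      letI := IwasawaAlgebra.isDiscreteValuationRing_quotient_X_pow_add_C p hm
      haveI := IwasawaAlgebra.EisensteinCoeff.isLocalRing_succ p hm
      letI := IwasawaAlgebra.EisensteinCoeff.algebraOfSpecSucc p m
      haveI := W.isScalarTower_algebraOfSpecSucc (K := K) (p := p) (m := m)
      letI := W.residueModuleSucc (K := K) (p := p) hm
      ∀ (S : Finset (IsDedekindDomain.HeightOneSpectrum (NumberField.RingOfIntegers K)))
        (hpS : ∀ v, ((p : ℕ) : NumberField.RingOfIntegers K) ∈ v.asIdeal → v ∈ S)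
        (hbad : ∀ v, v ∉ S → ((p : ℕ) : NumberField.RingOfIntegers K) ∉ v.asIdeal →
          (W.baseChange K).HasGoodReductionAt v)
        (_hSN : ∀ v ∈ S, ((p : ℕ) : NumberField.RingOfIntegers K) ∈ v.asIdeal ∨
          ((N : ℕ) : NumberField.RingOfIntegers K) ∈ v.asIdeal)
        (_hSσ : ∀ (σ : K ≃ₐ[ℚ] K) (v : IsDedekindDomain.HeightOneSpectrum (NumberField.RingOfIntegers K)),
          σ • v ∈ S → v ∈ S)
        (L : Set (IsDedekindDomain.HeightOneSpectrum (NumberField.RingOfIntegers K)))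
        (hL : L ⊆ (W.eisensteinTower (κ.unitTwist (-1)) hm).degreeTwoPrimes p)
        (hLS : ∀ v ∈ L, v ∉ S) (jbar' : AlgebraicClosure K →+* ℂ) (cd : ConjugationDatum K)
        (Dd : ∀ k, DualityDatum p cd ((W.eisensteinTower (κ.unitTwist (-1)) hm).ρ k)
          (IwasawaAlgebra.EisensteinCoeff p m (k + 1)))
        (fs : ∀ (k : ℕ) (n : Finset (IsDedekindDomain.HeightOneSpectrum (NumberField.RingOfIntegers K)))
          (v : IsDedekindDomain.HeightOneSpectrum (NumberField.RingOfIntegers K)),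
          galoisCohomology ((W.eisensteinLevelQuot (κ.unitTwist (-1)) hm k n).toLocal (Sum.inr v)) 1 →+
            SingularQuotient (GaloisRep.toLocal v (W.eisensteinLevelQuot (κ.unitTwist (-1)) hm k n)) ⊗[ℤ]
              Gell v)
        (hy : (W.eisensteinDVRSetting (κ.unitTwist (-1)) hm S hpS hbad L hL hLS jbar' cd Dd fs).SatisfiesH)
        (hπ : (W.eisensteinDVRSetting (κ.unitTwist (-1)) hm S hpS hbad L hL hLS jbar' cd Dd fs).π ∈ IsLocalRing.maximalIdeal (IwasawaAlgebra p ⧸ Ideal.span {(PowerSeries.X ^ m + PowerSeries.C (p : ℤ_[p]) : IwasawaAlgebra p)}))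
        (he : ∀ k, (W.eisensteinDVRSetting (κ.unitTwist (-1)) hm S hpS hbad L hL hLS jbar' cd Dd fs).e k ≤ (W.eisensteinDVRSetting (κ.unitTwist (-1)) hm S hpS hbad L hL hLS jbar' cd Dd fs).e (k + 1))
        (hπX : (W.eisensteinDVRSetting (κ.unitTwist (-1)) hm S hpS hbad L hL hLS jbar' cd Dd fs).π =
          Ideal.Quotient.mk (Ideal.span {(PowerSeries.X ^ m + PowerSeries.C (p : ℤ_[p]) : IwasawaAlgebra p)}) PowerSeries.X)
        (hek : ∀ k, (W.eisensteinDVRSetting (κ.unitTwist (-1)) hm S hpS hbad L hL hLS jbar' cd Dd fs).e (k + 1) - (W.eisensteinDVRSetting (κ.unitTwist (-1)) hm S hpS hbad L hL hLS jbar' cd Dd fs).e k = m),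
        Finite (↥((((W.baseChange K).conjSelmerInfty κ γ - 1) ^ m + (p : AddMonoid.End ((W.baseChange K).selmerInfty κ))).ker) ⧸ ((((W.eisensteinDVRSetting (κ.unitTwist (-1)) hm S hpS hbad L hL hLS jbar' cd Dd fs).T.selmerA (W.eisensteinDVRSetting (κ.unitTwist (-1)) hm S hpS hbad L hL hLS jbar' cd Dd fs).π (W.eisensteinDVRSetting (κ.unitTwist (-1)) hm S hpS hbad L hL hLS jbar' cd Dd fs).e hy.killed hy.ker_red hπ he (fun k ↦ ((W.eisensteinDVRSetting (κ.unitTwist (-1)) hm S hpS hbad L hL hLS jbar' cd Dd fs).t k).cond)).map (W.eisensteinTowerReadout κ hm (W.eisensteinDVRSetting (κ.unitTwist (-1)) hm S hpS hbad L hL hLS jbar' cd Dd fs).π (W.eisensteinDVRSetting (κ.unitTwist (-1)) hm S hpS hbad L hL hLS jbar' cd Dd fs).e hy.killed hy.ker_red hπ he hπX hek)).comap ((W.baseChange K).selmerInfty κ).subtype).addSubgroupOf ((((W.baseChange K).conjSelmerInfty κ γ - 1) ^ m + (p : AddMonoid.End ((W.baseChange K).selmerInfty κ))).ker)) ∧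
          Nat.card (↥((((W.baseChange K).conjSelmerInfty κ γ - 1) ^ m + (p : AddMonoid.End ((W.baseChange K).selmerInfty κ))).ker) ⧸ ((((W.eisensteinDVRSetting (κ.unitTwist (-1)) hm S hpS hbad L hL hLS jbar' cd Dd fs).T.selmerA (W.eisensteinDVRSetting (κ.unitTwist (-1)) hm S hpS hbad L hL hLS jbar' cd Dd fs).π (W.eisensteinDVRSetting (κ.unitTwist (-1)) hm S hpS hbad L hL hLS jbar' cd Dd fs).e hy.killed hy.ker_red hπ he (fun k ↦ ((W.eisensteinDVRSetting (κ.unitTwist (-1)) hm S hpS hbad L hL hLS jbar' cd Dd fs).t k).cond)).map (W.eisensteinTowerReadout κ hm (W.eisensteinDVRSetting (κ.unitTwist (-1)) hm S hpS hbad L hL hLS jbar' cd Dd fs).π (W.eisensteinDVRSetting (κ.unitTwist (-1)) hm S hpS hbad L hL hLS jbar' cd Dd fs).e hy.killed hy.ker_red hπ he hπX hek)).comap ((W.baseChange K).selmerInfty κ).subtype).addSubgroupOf ((((W.baseChange K).conjSelmerInfty κ γ - 1) ^ m + (p : AddMonoid.End ((W.baseChange K).selmerInfty κ))).ker)) ≤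 p ^ c

set_option synthInstance.maxHeartbeats 80000 in
/-- **Letter `Stmt.controlGlueMultAt p`** — x10b's `Stmt.controlGlue` on the twin frame at a fixed prime `p`, in the K2 stub's currency: for a `Λ`-adic
Selmer datum `D` (`𝔖 = D.S` finitely generated), a dual datum `X`, and ONE class `z ∈ 𝔖`, `z ≠ 0`, with `𝔖 ⧸ Λz` torsion, there
are m-UNIFORM constants `c, m₁` such that for every `m ≥ m₁` and every admissible Eisenstein datum, Howard's `Conclusion` of
Thm. 1.6.1 for the setting `S_m` at the control levels `(I.proj (k+1) (f_m z))_k` yields a `SpecWitness` for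
`(𝔖, X, Λz, q_m = T^m + p, p^c)` (the input of `HeegnerMuPartStabilized.HasSpecWitnesses`, hence of the K2 conjunct (H-iii)). -/
abbrev Stmt.controlGlueMultAt (p : ℕ) [Fact p.Prime] : Prop :=
  ∀ (N : ℕ) [NeZero N] (W : WeierstrassCurve ℚ) [W.IsElliptic] [W.IsGloballyMinimal] (K : Type) [Field K] [NumberField K]
    (κ : ZpExtension K p) (γ : Field.absoluteGaloisGroup K),
    IsImaginaryQuadratic K → p ≠ 2 → κ.IsAnticyclotomic → SatisfiesHeegnerHypothesis N K →
    ∀ (hγ : κ.IsTopGenerator γ) (hE : ∀ Q : (W.baseChange K).toAffine.Point, p • Q = 0 → Q = 0),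
    (∀ v : IsDedekindDomain.HeightOneSpectrum (NumberField.RingOfIntegers K),
      ((p : ℕ) : NumberField.RingOfIntegers K) ∈ v.asIdeal → (W.baseChange K).HasMultiplicativeReductionAt v) →
    ∀ (D : (W.baseChange K).LambdaAdicSelmerData κ γ)
      (X : (W.baseChange K).SelmerDualData κ γ) (z : D.S),
    Module.Finite (IwasawaAlgebra p) D.S →
    Module.IsTorsion (IwasawaAlgebra p) (D.S ⧸ Submodule.span (IwasawaAlgebra p) {z}) →
    z ≠ 0 →
    ∃ c m₁ : ℕ, ∀ (m : ℕ) (hm : 1 ≤ m), m₁ ≤ m →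
      letI := IwasawaAlgebra.isDomain_quotient_X_pow_add_C p hm
      letI := IwasawaAlgebra.isDiscreteValuationRing_quotient_X_pow_add_C p hm
      haveI := IwasawaAlgebra.EisensteinCoeff.isLocalRing_succ p hm
      letI := IwasawaAlgebra.EisensteinCoeff.algebraOfSpecSucc p m
      haveI := W.isScalarTower_algebraOfSpecSucc (K := K) (p := p) (m := m)
      letI := W.residueModuleSucc (K := K) (p := p) hm
      ∀ (S : Finset (IsDedekindDomain.HeightOneSpectrum (NumberField.RingOfIntegers K)))
        (hpS : ∀ v, ((p : ℕ) : NumberField.RingOfIntegers K) ∈ v.asIdeal → v ∈ S)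
        (hbad : ∀ v, v ∉ S → ((p : ℕ) : NumberField.RingOfIntegers K) ∉ v.asIdeal →
          (W.baseChange K).HasGoodReductionAt v)
        (_hSN : ∀ v ∈ S, ((p : ℕ) : NumberField.RingOfIntegers K) ∈ v.asIdeal ∨
          ((N : ℕ) : NumberField.RingOfIntegers K) ∈ v.asIdeal)
        (_hSσ : ∀ (σ : K ≃ₐ[ℚ] K) (v : IsDedekindDomain.HeightOneSpectrum (NumberField.RingOfIntegers K)),
          σ • v ∈ S → v ∈ S)
        (L : Set (IsDedekindDomain.HeightOneSpectrum (NumberField.RingOfIntegers K)))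
        (hL : L ⊆ (W.eisensteinTower (κ.unitTwist (-1)) hm).degreeTwoPrimes p)
        (hLS : ∀ v ∈ L, v ∉ S) (jbar' : AlgebraicClosure K →+* ℂ) (cd : ConjugationDatum K)
        (Dd : ∀ k, DualityDatum p cd ((W.eisensteinTower (κ.unitTwist (-1)) hm).ρ k)
          (IwasawaAlgebra.EisensteinCoeff p m (k + 1)))
        (fs : ∀ (k : ℕ) (n : Finset (IsDedekindDomain.HeightOneSpectrum (NumberField.RingOfIntegers K)))
          (v : IsDedekindDomain.HeightOneSpectrum (NumberField.RingOfIntegers K)),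
          galoisCohomology ((W.eisensteinLevelQuot (κ.unitTwist (-1)) hm k n).toLocal (Sum.inr v)) 1 →+
            SingularQuotient (GaloisRep.toLocal v (W.eisensteinLevelQuot (κ.unitTwist (-1)) hm k n)) ⊗[ℤ]
              Gell v)
        (t : ∀ k, ((W.baseChange K).torsionGaloisModule ((p : ℤ) ^ (k + 1))).toContRepresentation →ⁱL
          ((W.baseChange K).torsionGaloisModule ((p : ℤ) ^ k)).toContRepresentation)
        (ht : ∀ k (P : geomTorsion (W.baseChange K) ((p : ℤ) ^ (k + 1))),
          t k P = (W.baseChange K).geomTorsionReduce p k P)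
        (I : ZpExtension.EisensteinH1Data (κ.unitTwist (-1))
          (fun k ↦ (W.baseChange K).torsionGaloisModule ((p : ℤ) ^ k)) t hm)
        (hy : (W.eisensteinDVRSetting (κ.unitTwist (-1)) hm S hpS hbad L hL hLS jbar' cd Dd fs).SatisfiesH),
        (W.eisensteinDVRSetting (κ.unitTwist (-1)) hm S hpS hbad L hL hLS jbar' cd Dd fs).Conclusion hy
            (fun k ↦ I.proj (k + 1) (D.toEisensteinH1Linear hm t ht I hγ hE z)) →
          Nonempty (HeegnerMuPartStabilized.SpecWitness (IwasawaAlgebra p) D.S X.X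
            (Submodule.span (IwasawaAlgebra p) {z})
            (PowerSeries.X ^ m + PowerSeries.C (p : ℤ_[p]) : IwasawaAlgebra p) (p ^ c))

/-! ## §2 The assembly -/

set_option maxHeartbeats 1600000 in
set_option synthInstance.maxHeartbeats 80000 in
/-- **The control glue at a fixed prime from the two readout clauses at that prime** (x10b's `controlGlue_of_clauses` VERBATIM but for the frame; see `UniversalToricDescentTwinControlGlueOfClauses`).
[cite: Howard2004HeegnerKolyvagin, Thm. 1.6.1, Prop. 2.2.8 and proof of Thm. 2.2.10 (𝔮 = T^m + p)]
[cite: GreenbergLNM1716, Prop. 2.4 and §4 p. 98] [cite: MastellaZerman2026, Thm. 2.40] -/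
theorem controlGlueMultAt_of_clauses {p : ℕ} [Fact p.Prime] (hB4 : Stmt.readoutSelmerMultAt p)
    (hB5 : Stmt.readoutIndexMultAt p) : Stmt.controlGlueMultAt p := by
  intro N _ W _ _ K _ _ κ γ hK hp2 hκ hHeeg hγ hE hmultp D X z hfinS htor hz0
  haveI : Module.Finite (IwasawaAlgebra p) D.S := hfinS
  have htor' : Module.IsTorsion (IwasawaAlgebra p) (D.S ⧸ (IwasawaAlgebra p) ∙ z) := htor
  -- the m-UNIFORM constants: compact side (p660971), (B4), (B5)
  obtain ⟨n₁, m₂, hA⟩ := PrintX10bCompactControl.exists_forall_compactInputs_eisensteinDVRSetting W K p κ γ D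
    hγ hE z hz0 htor'
  obtain ⟨m₄, hSelAll⟩ := hB4 N W K κ γ hK hp2 hκ hHeeg hγ hE hmultp
  obtain ⟨c₂, m₃, hIdxAll⟩ := hB5 N W K κ γ hK hp2 hκ hHeeg hγ hE hmultp
  refine ⟨max (p ^ n₁) c₂, p ^ n₁ + 1 + m₂ + m₃ + m₄, fun m hm hmle ↦ ?_⟩
  letI := IwasawaAlgebra.isDomain_quotient_X_pow_add_C p hm
  letI := IwasawaAlgebra.isDiscreteValuationRing_quotient_X_pow_add_C p hm
  haveI := IwasawaAlgebra.EisensteinCoeff.isLocalRing_succ p hm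
  letI := IwasawaAlgebra.EisensteinCoeff.algebraOfSpecSucc p m
  haveI := W.isScalarTower_algebraOfSpecSucc (K := K) (p := p) (m := m)
  letI := W.residueModuleSucc (K := K) (p := p) hm
  have hn₁m : p ^ n₁ < m := by omega
  have hm₂m : m₂ ≤ m := by omega
  have hm₃m : m₃ ≤ m := by omega
  have hm₄m : m₄ ≤ m := by omega
  have hppos : 0 < p := (Fact.out : p.Prime).pos
  intro S hpS hbad hSN hSσ L hL hLS jbar' cd Dd fs t ht I hy hconc
  obtain rfl := PrintX10bCompactControl.eq_torsionGaloisModuleReduce t ht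
  have ht' : ∀ k, Function.Surjective ((W.baseChange K).torsionGaloisModuleReduce p k) :=
    fun k ↦ (W.baseChange K).torsionGaloisModuleReduce_surjective p k
  -- the four bookkeeping proofs of the readout
  have hπ₀ : (W.eisensteinDVRSetting (κ.unitTwist (-1)) hm S hpS hbad L hL hLS jbar' cd Dd fs).π ∈ IsLocalRing.maximalIdeal (IwasawaAlgebra p ⧸ Ideal.span {(PowerSeries.X ^ m + PowerSeries.C (p : ℤ_[p]) : IwasawaAlgebra p)}) := by
    rw [hy.unif]; exact Ideal.mem_span_singleton_self _
  have he₀ : ∀ k, (W.eisensteinDVRSetting (κ.unitTwist (-1)) hm S hpS hbad L hL hLS jbar' cd Dd fs).e k ≤ (W.eisensteinDVRSetting (κ.unitTwist (-1)) hm S hpS hbad L hL hLS jbar' cd Dd fs).e (k + 1) := fun k ↦ (hy.e_strictMono (Nat.lt_succ_self k)).le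
  have hπX : (W.eisensteinDVRSetting (κ.unitTwist (-1)) hm S hpS hbad L hL hLS jbar' cd Dd fs).π = Ideal.Quotient.mk (Ideal.span {(PowerSeries.X ^ m + PowerSeries.C (p : ℤ_[p]) : IwasawaAlgebra p)}) PowerSeries.X := rfl
  have hek : ∀ k, (W.eisensteinDVRSetting (κ.unitTwist (-1)) hm S hpS hbad L hL hLS jbar' cd Dd fs).e (k + 1) - (W.eisensteinDVRSetting (κ.unitTwist (-1)) hm S hpS hbad L hL hLS jbar' cd Dd fs).e k = m := by
    intro k
    rw [W.eisensteinDVRSetting_e, W.eisensteinDVRSetting_e, Nat.mul_succ, Nat.add_sub_cancel_left]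
  -- (B4), (B5) at this `m` and datum
  have hSel := hSelAll m hm hm₄m S hpS hbad hSN hSσ L hL hLS jbar' cd Dd fs hy hπ₀ he₀ hπX hek
  obtain ⟨hfin, hidx⟩ := hIdxAll m hm hm₃m S hpS hbad hSN hSσ L hL hLS jbar' cd Dd fs hy hπ₀ he₀ hπX hek
  -- the control image lies in the pinned `H¹_{F_𝔮}` (ORD-ASCENT, p661609)
  have hf := fun s ↦ LambdaAdicSelmerData.toEisensteinH1Linear_mem_ordinarySelmer_of_multiplicative D hm _ ht I hγ hE S
    (fun v hv ↦ WeierstrassCurve.mem_of_mem_badPlaces (p := p) S hpS hbad v hv) s hp2 hmultp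
  -- the honest `S_m`-module `H := H¹_{F_𝔮}(K, T_𝔮)` (p658581)
  letI := (I.isTorsionBy_qm_submodule (I.selmerSubmodule ((κ.unitTwist (-1)).eisensteinSelmerStructure (fun k ↦ (W.baseChange K).torsionGaloisModule ((p : ℤ) ^ k)) (fun k ↦ (W.baseChange K).torsionGaloisModuleReduce p k) hm S (fun v _ ↦ (W.baseChange K).ordinaryFiltrationAt v (fun k ↦ (W.baseChange K).torsionGaloisModuleReduce p k) ht)) (fun k c x hx ↦ (κ.unitTwist (-1)).map_eisensteinTwistSMulHom_mem_selmerGroup (fun k ↦ (W.baseChange K).torsionGaloisModule ((p : ℤ) ^ k)) (fun k ↦ (W.baseChange K).torsionGaloisModuleReduce p k) hm S (fun v _ ↦ (W.baseChange K).ordinaryFiltrationAt v (fun k ↦ (W.baseChange K).torsionGaloisModuleReduce p k) ht) k c x hx))).module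
  haveI := I.isScalarTower_qm_submodule (I.selmerSubmodule ((κ.unitTwist (-1)).eisensteinSelmerStructure (fun k ↦ (W.baseChange K).torsionGaloisModule ((p : ℤ) ^ k)) (fun k ↦ (W.baseChange K).torsionGaloisModuleReduce p k) hm S (fun v _ ↦ (W.baseChange K).ordinaryFiltrationAt v (fun k ↦ (W.baseChange K).torsionGaloisModuleReduce p k) ht)) (fun k c x hx ↦ (κ.unitTwist (-1)).map_eisensteinTwistSMulHom_mem_selmerGroup (fun k ↦ (W.baseChange K).torsionGaloisModule ((p : ℤ) ^ k)) (fun k ↦ (W.baseChange K).torsionGaloisModuleReduce p k) hm S (fun v _ ↦ (W.baseChange K).ordinaryFiltrationAt v (fun k ↦ (W.baseChange K).torsionGaloisModuleReduce p k) ht) k c x hx))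
  -- Howard's conclusion (i), for the compact turnkey (the conclusion itself stays available, unopened)
  have hconc' := hconc
  obtain ⟨x, hfree, -⟩ := hconc'
  obtain ⟨⟨hcoker, hcoker_le⟩, hfz⟩ := hA m hm hn₁m hm₂m S hpS hbad L hL hLS jbar' cd Dd fs _ ht I hf x hfree
  -- the discrete turnkey (p669215)
  exact HeegnerMuPartStabilized.nonempty_specWitness_of_dvrConclusion_of_readout hm
    (Submodule.span (IwasawaAlgebra p) {z}) (W.baseChange K) hγ X
    (W.eisensteinDVRSetting (κ.unitTwist (-1)) hm S hpS hbad L hL hLS jbar' cd Dd fs) hy hπ₀ he₀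
    (fun k ↦ I.proj (k + 1) (D.toEisensteinH1Linear hm _ ht I hγ hE z))
    (PrintX10bCompactControl.proj_succ_mem_limitSelmer_eisensteinDVRSetting W K p κ hm S hpS hbad L hL hLS jbar' cd
      Dd fs _ ht I (hf z))
    (PrintX10bCompactControl.proj_succ_ne_zero I ht' hfz) hconc
    ((AddMonoidHom.pi (fun k ↦ I.proj (k + 1))).comp (I.selmerSubmodule ((κ.unitTwist (-1)).eisensteinSelmerStructure (fun k ↦ (W.baseChange K).torsionGaloisModule ((p : ℤ) ^ k)) (fun k ↦ (W.baseChange K).torsionGaloisModuleReduce p k) hm S (fun v _ ↦ (W.baseChange K).ordinaryFiltrationAt v (fun k ↦ (W.baseChange K).torsionGaloisModuleReduce p k) ht)) (fun k c x hx ↦ (κ.unitTwist (-1)).map_eisensteinTwistSMulHom_mem_selmerGroup (fun k ↦ (W.baseChange K).torsionGaloisModule ((p : ℤ) ^ k)) (fun k ↦ (W.baseChange K).torsionGaloisModuleReduce p k) hm S (fun v _ ↦ (W.baseChange K).ordinaryFiltrationAt v (fun k ↦ (W.baseChange K).torsionGaloisModuleReduce p k) ht) k c x hx)).subtype.toAd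dMonoidHom)
    ((I.injective_projSucc ht').comp Subtype.val_injective)
    (fun y ↦ I.mem_limitSelmer_succ_iff_mem_range ht' S _ y)
    (fun r y ↦ I.projSucc_smul ht' (I.selmerSubmodule ((κ.unitTwist (-1)).eisensteinSelmerStructure (fun k ↦ (W.baseChange K).torsionGaloisModule ((p : ℤ) ^ k)) (fun k ↦ (W.baseChange K).torsionGaloisModuleReduce p k) hm S (fun v _ ↦ (W.baseChange K).ordinaryFiltrationAt v (fun k ↦ (W.baseChange K).torsionGaloisModuleReduce p k) ht)) (fun k c x hx ↦ (κ.unitTwist (-1)).map_eisensteinTwistSMulHom_mem_selmerGroup (fun k ↦ (W.baseChange K).torsionGaloisModule ((p : ℤ) ^ k)) (fun k ↦ (W.baseChange K).torsionGaloisModuleReduce p k) hm S (fun v _ ↦ (W.baseChange K).ordinaryFiltrationAt v (fun k ↦ (W.baseChange K).torsionGaloisModuleReduce p k) ht) k c x hx)) r y)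
    ((D.toEisensteinH1Linear hm _ ht I hγ hE).codRestrict (I.selmerSubmodule ((κ.unitTwist (-1)).eisensteinSelmerStructure (fun k ↦ (W.baseChange K).torsionGaloisModule ((p : ℤ) ^ k)) (fun k ↦ (W.baseChange K).torsionGaloisModuleReduce p k) hm S (fun v _ ↦ (W.baseChange K).ordinaryFiltrationAt v (fun k ↦ (W.baseChange K).torsionGaloisModuleReduce p k) ht)) (fun k c x hx ↦ (κ.unitTwist (-1)).map_eisensteinTwistSMulHom_mem_selmerGroup (fun k ↦ (W.baseChange K).torsionGaloisModule ((p : ℤ) ^ k)) (fun k ↦ (W.baseChange K).torsionGaloisModuleReduce p k) hm S (fun v _ ↦ (W.baseChange K).ordinaryFiltrationAt v (fun k ↦ (W.baseChange K).torsionGaloisModuleReduce p k) ht) k c x hx)) hf)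
    ((D.toEisensteinH1Linear hm _ ht I hγ hE).codRestrict (I.selmerSubmodule ((κ.unitTwist (-1)).eisensteinSelmerStructure (fun k ↦ (W.baseChange K).torsionGaloisModule ((p : ℤ) ^ k)) (fun k ↦ (W.baseChange K).torsionGaloisModuleReduce p k) hm S (fun v _ ↦ (W.baseChange K).ordinaryFiltrationAt v (fun k ↦ (W.baseChange K).torsionGaloisModuleReduce p k) ht)) (fun k c x hx ↦ (κ.unitTwist (-1)).map_eisensteinTwistSMulHom_mem_selmerGroup (fun k ↦ (W.baseChange K).torsionGaloisModule ((p : ℤ) ^ k)) (fun k ↦ (W.baseChange K).torsionGaloisModuleReduce p k) hm S (fun v _ ↦ (W.baseChange K).ordinaryFiltrationAt v (fun k ↦ (W.baseChange K).torsionGaloisModuleReduce p k) ht) k c x hx)) hf z) rfl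
    (by rw [Submodule.map_span, Set.image_singleton])
    (p ^ max (p ^ n₁) c₂) hcoker (hcoker_le.trans (Nat.pow_le_pow_right hppos (le_max_left _ _)))
    (W.eisensteinTowerReadout κ hm (W.eisensteinDVRSetting (κ.unitTwist (-1)) hm S hpS hbad L hL hLS jbar' cd Dd fs).π (W.eisensteinDVRSetting (κ.unitTwist (-1)) hm S hpS hbad L hL hLS jbar' cd Dd fs).e hy.killed hy.ker_red hπ₀ he₀ hπX hek)
    ((W.baseChange K).conjH1 p κ.kerSubgroup γ) (fun _ ↦ rfl)
    (fun j cj ↦ W.eisensteinTowerReadout_of_scalarMapH1_mk_X κ hm (W.eisensteinDVRSetting (κ.unitTwist (-1)) hm S hpS hbad L hL hLS jbar' cd Dd fs).π (W.eisensteinDVRSetting (κ.unitTwist (-1)) hm S hpS hbad L hL hLS jbar' cd Dd fs).e hy.killed hy.ker_red hπ₀ he₀ hπX hek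
      hγ _ (fun _ ↦ rfl) j cj)
    hSel hfin (hidx.trans (Nat.pow_le_pow_right hppos (le_max_right _ _)))

/-! ## §3 (B4) at every prime; the glue from (B5) alone -/

/-- **(B4) at a fixed prime** — the closed theorem `readoutSelmerMult_holds` (p764670) read at `p`.
[cite: Howard2004HeegnerKolyvagin, Lemma 2.2.7 / Prop. 2.2.8 and proof of Thm. 2.2.10 (𝔮 = T^m + p)] -/
theorem readoutSelmerMultAt_holds (p : ℕ) [Fact p.Prime] : Stmt.readoutSelmerMultAt p := by
  intro N _ W _ _ K _ _ κ γ
  exact readoutSelmerMult_holds N W K p κ γ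

/-- **At a fixed prime the control glue needs only (B5)**: `Stmt.readoutIndexMultAt p → Stmt.controlGlueMultAt p`.
[cite: Howard2004HeegnerKolyvagin, Thm. 1.6.1, Prop. 2.2.8 and proof of Thm. 2.2.10 (𝔮 = T^m + p)] -/
theorem controlGlueMultAt_of_readoutIndexMultAt {p : ℕ} [Fact p.Prime] (hB5 : Stmt.readoutIndexMultAt p) :
    Stmt.controlGlueMultAt p :=
  controlGlueMultAt_of_clauses (readoutSelmerMultAt_holds p) hB5

end Summit.BirchSwinnertonDyer.BirchSwinnertonDyer.Theorems.UniversalToricDescentTwinControlGlue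

end
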